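import Literature.Barriers.ValiantsHypothesis.BDGIL24GelfandTsetlinProjectorLength
import HarnessLib

/-!
# [BDGIL24, Def. 5.1 / Table 5.3]: the DIVERSITY of the metapolynomials `ℂ[ℂ[x₁,…,x_k]_d]_δ` — at
# most `(δd+1)^k` weights, at most `(δd+1)^k` isotypic types, at most `(δd+1)^{k²}` Gelfand–Tsetlin
# types occur — PROVED (`BergEtAl2024.diversity_weights_le`, `diversity_isotypic_le`, `diversity_gt_le`)

[BDGIL24] = M. van den Berg, P. Dutta, F. Gesmundo, C. Ikenmeyer, V. Lysikov, *Algebraic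
metacomplexity and representation theory*, arXiv:2411.03444, §5.1 (p.25–28, PDF p.26–29; held text
paper:arxiv-2411.03444):

> **Definition 5.1.** Let `V` be a completely reducible representation of an algebra `A`. We call
> the number of isomorphism types of irreducible subrepresentations of `V` the *diversity* of `V`.
> (p0026.txt:L13–L14)
> Table 5.3 (isotypic components of `ℂ[ℂ[x₁,…,x_k]_d]_δ`): Diversity `≤ (δd)^k` (weight spaces),
> `≤ (δd)^k` (`λ`-isotypic spaces), `≤ (δd)^{k²}` (`T`-isotypic spaces). (p0027.txt:L1–L10)
> §5.1.1: "the diversity of `V` as a representation of `𝔥` …, that is, the number of weights of `V`"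
> … "The weights appearing in `W` correspond to `k`-tuples of non-negative integers summing to `δd`,
> so `p ≤ (δd)^k`" (p0028.txt:L13–L22); §5.1.2: "Since every highest weight is a weight, the
> diversity of `ℂ[ℂ[x₁,…,x_k]_d]_δ` is bounded by `(dδ)^k`" (p0028.txt:L40–L41); §5.1.4: "there are
> at most `binom(dδ+k−1, k−1) ≤ (dδ)^k` tuples that can serve as rows of a tableau, and therefore at
> most `(dδ)^{k²}` possible semistandard tableaux" (p0029.txt:L16–L21).

## What is typed and proved (theorem-only; the three "Diversity" entries of Table 5.3)

For the degree-`δ` metapolynomials (`Δ.IsHomogeneous δ`, the tree's format `(δ, d, k)`) and the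
representation `coordRep (Fin k) ℂ d` of `GL_k`:
* `occurringWeights_subset_weightBox`, **`diversity_weights_le`** — the weights `μ` carrying a nonzero
  weight vector of degree `δ` lie in the tree's `weightBox k d δ`; there are at most `(δd+1)^k` of them;
* `occurringTypes_subset_weightBox`, **`diversity_isotypic_le`** — the isotypic types `λ` (highest
  weights with `hwSubrep λ ∩ ℂ[ℂ[x]_d]_δ ≠ 0`) lie in the weight box: diversity `≤ (δd+1)^k`;
* `occurringGTPatterns_subset`, **`diversity_gt_le`** — the Gelfand–Tsetlin types `T` (chains of
  level highest weights, `GTPattern`, with `gtSubspace T ∩ ℂ[ℂ[x]_d]_δ ≠ 0`) lie in the product of the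
  level weight boxes: at most `(δd+1)^{k²}` of them.

Deviation (disclosed, as in all BDGIL24 files of the tree): the box count `(δd+1)` replaces the
printed `(δd)` (the printed `binom(δd+k−1,k−1) ≤ (δd)^k` fails for `δd = 1`, `k ≥ 2`;
`card_weightBox_le`). The counts are the ones used inside the length bounds `cor_5_5_length`,
`cor_5_6_length`, `cor_5_8_length`; here they are stated as the printed diversity bounds. The sets
are sets of TYPES (`Weight (Fin k)`, `GTPattern k`), counted with `Set.ncard`.

Honest framing: bookkeeping; nothing here bears on `VP ≠ VNP`, which is NOT proved.

## References
* [BergEtAl2024] arXiv:2411.03444, Def. 5.1, Table 5.3, §5.1.1–5.1.4 (p.25–28, PDF p.26–29).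
-/

noncomputable section

open MvPolynomial
open scoped BigOperators

namespace Literature.Barriers.ValiantsHypothesis

namespace BergEtAl2024

open Literature.Computability.AlgebraicComplexity Literature.NumberTheory.DiophantineGeometry

variable {k d : ℕ}

/-! ### Weights (Table 5.3, column 1; §5.1.1) -/

/-- **The weights occurring in `ℂ[ℂ[x₁,…,x_k]_d]_δ` lie in the box** (the weight of a nonzero
homogeneous weight vector of degree `δ` is the weight of any of its metamonomials, a `k`-tuple of
non-positive integers summing to `−δd` in the tree's dual convention).
[cite: BergEtAl2024, §5.1.1, p.27 (PDF p.28)] locator: paper:arxiv-2411.03444 p0028.txt:L18–L22 -/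
theorem occurringWeights_subset_weightBox (δ : ℕ) :
    {μ : Weight (Fin k) | ∃ F : MvPolynomial (DegIdx (Fin k) d) ℂ,
        F.IsHomogeneous δ ∧ F ≠ 0 ∧ F ∈ weightSpace (coordRep (Fin k) ℂ d) μ} ⊆
      ↑(weightBox k d δ) := by
  rintro μ ⟨F, hFδ, hF0, hFμ⟩
  exact mem_weightBox_of_mem_weightSpace_glLift le_rfl hFδ (by rwa [comp_glLift_refl]) hF0

/-- **Diversity of `ℂ[ℂ[x₁,…,x_k]_d]_δ` as a representation of `𝔥` (= the number of weights,
Table 5.3 column 1): at most `(δd+1)^k`.**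
[cite: BergEtAl2024, Def. 5.1 / Table 5.3 / §5.1.1, p.25–27 (PDF p.26–28)] locator: paper:arxiv-2411.03444 p0027.txt:L8, p0028.txt:L13–L22 -/
theorem diversity_weights_le (δ : ℕ) :
    {μ : Weight (Fin k) | ∃ F : MvPolynomial (DegIdx (Fin k) d) ℂ,
        F.IsHomogeneous δ ∧ F ≠ 0 ∧ F ∈ weightSpace (coordRep (Fin k) ℂ d) μ}.ncard ≤
      (δ * d + 1) ^ k := by
  refine (Set.ncard_le_ncard (occurringWeights_subset_weightBox (k := k) (d := d) δ)
    (weightBox k d δ).finite_toSet).trans ?_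
  rw [Set.ncard_coe_finset]
  exact card_weightBox_le k d δ

/-! ### Isotypic types (Table 5.3, column 2; §5.1.2) -/

/-- **The isotypic types occurring in `ℂ[ℂ[x₁,…,x_k]_d]_δ` lie in the weight box** ("every highest
weight is a weight"). [cite: BergEtAl2024, §5.1.2, p.27 (PDF p.28)] locator: paper:arxiv-2411.03444 p0028.txt:L40–L41 -/
theorem occurringTypes_subset_weightBox (δ : ℕ) :
    {χ : Weight (Fin k) | ∃ F : MvPolynomial (DegIdx (Fin k) d) ℂ,
        F.IsHomogeneous δ ∧ F ≠ 0 ∧ F ∈ hwSubrep (coordRep (Fin k) ℂ d) χ} ⊆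
      ↑(weightBox k d δ) := by
  rintro χ ⟨F, hFδ, hF0, hFχ⟩
  exact (mem_weightBox_of_mem_hwSubrep hFδ hFχ hF0).1

/-- **Diversity of `ℂ[ℂ[x₁,…,x_k]_d]_δ` as a representation of `gl_k` (Def. 5.1: the number of
isomorphism types `λ` of irreducible subrepresentations, i.e. of nonzero `λ`-isotypic components;
Table 5.3 column 2): at most `(δd+1)^k`.**
[cite: BergEtAl2024, Def. 5.1 / Table 5.3 / §5.1.2, p.25–27 (PDF p.26–28)] locator: paper:arxiv-2411.03444 p0026.txt:L13–L14, p0027.txt:L8, p0028.txt:L40–L41 -/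
theorem diversity_isotypic_le (δ : ℕ) :
    {χ : Weight (Fin k) | ∃ F : MvPolynomial (DegIdx (Fin k) d) ℂ,
        F.IsHomogeneous δ ∧ F ≠ 0 ∧ F ∈ hwSubrep (coordRep (Fin k) ℂ d) χ}.ncard ≤
      (δ * d + 1) ^ k := by
  refine (Set.ncard_le_ncard (occurringTypes_subset_weightBox (k := k) (d := d) δ)
    (weightBox k d δ).finite_toSet).trans ?_
  rw [Set.ncard_coe_finset]
  exact card_weightBox_le k d δ

/-! ### Gelfand–Tsetlin types (Table 5.3, column 3; §5.1.4) -/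

/-- **The Gelfand–Tsetlin types occurring in `ℂ[ℂ[x₁,…,x_k]_d]_δ`** (chains `T = (λ^{(j)})_{j ≤ k}` of
level highest weights with a nonzero `T`-isotypic vector of degree `δ`) **have every level weight in
the level box** ("each row of a tableau is an ordered tuple of integers from `{1,…,k}`, so there are
at most `binom(dδ+k−1,k−1) ≤ (dδ)^k` tuples that can serve as rows").
[cite: BergEtAl2024, §5.1.4, p.28 (PDF p.29)] locator: paper:arxiv-2411.03444 p0029.txt:L16–L21 -/
theorem occurringGTPatterns_subset (δ : ℕ) :
    {T : GTPattern k | ∃ F : MvPolynomial (DegIdx (Fin k) d) ℂ,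
        F.IsHomogeneous δ ∧ F ≠ 0 ∧ F ∈ gtSubspace (coordRep (Fin k) ℂ d) T} ⊆
      ↑(Fintype.piFinset fun j : Fin (k + 1) => weightBox (j : ℕ) d δ) := by
  rintro T ⟨F, hFδ, hF0, hFT⟩
  rw [Finset.mem_coe, Fintype.mem_piFinset]
  intro j
  exact (mem_weightBox_of_mem_hwSubrep_glLift (level_le j) hFδ
    ((mem_gtSubspace_iff _ _ _).1 hFT j) hF0).1

/-- **Diversity of `ℂ[ℂ[x₁,…,x_k]_d]_δ` as a representation of the Gelfand–Tsetlin algebra `GZ(gl_k)`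
(the number of `T`-isotypic types; Table 5.3 column 3): at most `(δd+1)^{k²}`** ("and therefore at
most `(dδ)^{k²}` possible semistandard tableaux"; `card_piFinset_weightBox_le`:
`∏_{j ≤ k} (δd+1)^j ≤ (δd+1)^{k²}`).
[cite: BergEtAl2024, Def. 5.1 / Table 5.3 / §5.1.4, p.25–28 (PDF p.26–29)] locator: paper:arxiv-2411.03444 p0027.txt:L8, p0029.txt:L16–L21 -/
theorem diversity_gt_le (δ : ℕ) :
    {T : GTPattern k | ∃ F : MvPolynomial (DegIdx (Fin k) d) ℂ,
        F.IsHomogeneous δ ∧ F ≠ 0 ∧ F ∈ gtSubspace (coordRep (Fin k) ℂ d) T}.ncard ≤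
      (δ * d + 1) ^ (k ^ 2) := by
  refine (Set.ncard_le_ncard (occurringGTPatterns_subset (k := k) (d := d) δ)
    (Finset.finite_toSet _)).trans ?_
  rw [Set.ncard_coe_finset]
  exact card_piFinset_weightBox_le k d δ

end BergEtAl2024

end Literature.Barriers.ValiantsHypothesis
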